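import Mathlib
import Summits.RiemannHypothesis.RiemannHypothesis.Theorems.WeilFarFloorFormPolarization
import Summits.RiemannHypothesis.RiemannHypothesis.Theorems.WeilFarFloorCouplingTransfer
import HarnessLib

/-!
# The two-direction Rayleigh bound: a second-order LOWER bound for the far-coercivity floor (RH-free)

Helper file (`--supports stmt-RiemannHypothesis-0098`, lead-track anchor: Weil-positivity window ladder, format-C far bound),
pure proofs, RH-free, standard axioms.  Seat rh-explicit-weil-1 gen14 (memo
`run/shared/lean/pub/rh-explicit/rh-explicit-weil-1/FORMAT-K3.md` §15.5, §15.7).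

The floor `λ_max(b) = farCoercivityFloor b` is the supremum of the Rayleigh quotients `Q_b(g)/∫g²` of the prime-shift form.
Testing with a TWO-direction family `g = f + t·v` (`∫ f v = 0`) and the polarization identity
`Q_b(f + t v) = Q_b(f) + t²Q_b(v) + 2t∫(T_b f)·v` (`FloorCoshSplit.primeShiftForm_smul_add`, with the prime-shift operator
`(T_b f)(x) = Σ_{log n<2b} (Λ(n)/√n)(f(x − log n) + f(x + log n))`) gives, for every `t`,

`(Q_b(f) + 2t∫(T_b f)v + t²Q_b(v)) / (∫f² + t²∫v²) ≤ λ_max(b)`            (`rayleighTwo_le_farCoercivityFloor`).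

Along the cosh profile `C_b = 1_{[−b,b]}cosh(·/2)` (`N = ∫C_b² = b + sinh b`, `R_c = Q_b(C_b)/N` the cosh quotient) with the
RESIDUAL direction `r = 1_{[−b,b]}·(T_bC_b − R_c C_b)` one has `∫ C_b r = 0` and `∫ (T_bC_b) r = ∫ r² =: ρ` EXACTLY
(`integral_coshTest_mul_residual`, `integral_primeShiftOp_coshTest_mul_residual`), whence

`(R_c N + 2tρ + t²Q_b(r)) / (N + t²ρ) ≤ λ_max(b)` for all `t`                 (`coshResidual_rayleighTwo_le_farCoercivityFloor`),

and at `t = 1/R_c` (`R_c > 0`):  `R_c + (ρ/R_c + Q_b(r)/R_c²)/(N + ρ/R_c²) ≤ λ_max(b)`  (`coshQuotient_add_secondOrder_le_farCoercivityFloor`).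
This is the THEOREM-grade lower half of the second-order law `λ_max − R_c ≈ J/R_c`, `J = ρ/N` (memo §15.5: calibrated to
0.92–0.96 of the Galerkin gaps at a = 2…6), exact up to the sign of the residual's own form `Q_b(r)` (§15.7 names the missing
input: a lower bound for the prime-pair correlation `Q_b(r)`).  Nothing here bears on the truth of RH.
-/

set_option linter.dupNamespace false
set_option autoImplicit false

noncomputable section

open MeasureTheory Set Filter
open scoped Real Topology ArithmeticFunction.vonMangoldt

namespace Summit.RiemannHypothesis.RiemannHypothesis.Theorems.WeilFormatC

namespace FloorSecondOrder

open Literature.NumberTheory.LFunctions FloorCoshSplit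

variable {b : ℝ} {f v : ℝ → ℝ} {Cf Cv : ℝ}

/-! ## §1 The two-direction Rayleigh bound -/

/-- Homogeneity of the prime-shift form: `Q_b(t·v) = t²·Q_b(v)`. -/
theorem primeShiftForm_const_mul (v : ℝ → ℝ) (t : ℝ) :
    primeShiftForm b (fun x ↦ t * v x) = t ^ 2 * primeShiftForm b v := by
  unfold primeShiftForm
  rw [Finset.mul_sum]
  refine Finset.sum_congr rfl fun n _ ↦ ?_
  have e : (fun x ↦ t * v (x - Real.log n) * (t * v x)) = fun x ↦ t ^ 2 * (v (x - Real.log n) * v x) :=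
    funext fun x ↦ by ring
  rw [e, integral_const_mul]
  ring

/-- `∫ (f + t v)² = ∫ f² + t² ∫ v²` for admissible `f ⊥ v`. -/
theorem integral_sq_add_smul_eq (hf : Measurable f) (hv : Measurable v) (hCf : ∀ x, |f x| ≤ Cf)
    (hCv : ∀ x, |v x| ≤ Cv) (hfs : ∀ x, x ∉ Icc (-b) b → f x = 0) (hvs : ∀ x, x ∉ Icc (-b) b → v x = 0)
    (horth : ∫ x, f x * v x = 0) (t : ℝ) :
    ∫ x, (f x + t * v x) ^ 2 = (∫ x, f x ^ 2) + t ^ 2 * ∫ x, v x ^ 2 := by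
  have i1 : Integrable fun x ↦ f x ^ 2 := integrable_sq_admissible hf hCf hfs
  have i2 : Integrable fun x ↦ v x ^ 2 := integrable_sq_admissible hv hCv hvs
  have i3 : Integrable fun x ↦ f x * v x := integrable_mul_admissible hf hCf hv hCv hvs
  have e : (fun x ↦ (f x + t * v x) ^ 2) = fun x ↦ f x ^ 2 + (2 * t) * (f x * v x) + t ^ 2 * v x ^ 2 :=
    funext fun x ↦ by ring
  have h1 : ∫ x, f x ^ 2 + (2 * t) * (f x * v x) + t ^ 2 * v x ^ 2
      = (∫ x, f x ^ 2 + (2 * t) * (f x * v x)) + ∫ x, t ^ 2 * v x ^ 2 :=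
    integral_add (i1.add (i3.const_mul _)) (i2.const_mul _)
  have h2 : ∫ x, f x ^ 2 + (2 * t) * (f x * v x) = (∫ x, f x ^ 2) + ∫ x, (2 * t) * (f x * v x) :=
    integral_add i1 (i3.const_mul _)
  rw [e, h1, h2, integral_const_mul, integral_const_mul, horth, mul_zero, add_zero]

/-- **The two-direction Rayleigh bound (RH-free).** For admissible `f, v` on `[−b, b]` with `∫ f v = 0`, `∫ f² > 0` and every
real `t`: `(Q_b(f) + 2t∫(T_b f)·v + t²Q_b(v)) / (∫f² + t²∫v²) ≤ λ_max(b)`. -/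
theorem rayleighTwo_le_farCoercivityFloor (hf : Measurable f) (hv : Measurable v) (hCf : ∀ x, |f x| ≤ Cf)
    (hCv : ∀ x, |v x| ≤ Cv) (hfs : ∀ x, x ∉ Icc (-b) b → f x = 0) (hvs : ∀ x, x ∉ Icc (-b) b → v x = 0)
    (horth : ∫ x, f x * v x = 0) (hpos : 0 < ∫ x, f x ^ 2) (t : ℝ) :
    (primeShiftForm b f
        + 2 * t * (∫ x, (∑ n ∈ weilPrimeIndex b, (Λ n : ℝ) / Real.sqrt n * (f (x - Real.log n) + f (x + Real.log n))) * v x)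
        + t ^ 2 * primeShiftForm b v) / ((∫ x, f x ^ 2) + t ^ 2 * ∫ x, v x ^ 2)
      ≤ farCoercivityFloor b := by
  set g : ℝ → ℝ := fun x ↦ f x + t * v x with hg
  have hgm : Measurable g := hf.add (hv.const_mul t)
  have hgb : ∀ x, |g x| ≤ Cf + |t| * Cv := fun x ↦ by
    have h1 := hCf x
    have h2 := hCv x
    calc |g x| = |f x + t * v x| := rfl
      _ ≤ |f x| + |t * v x| := abs_add_le _ _
      _ = |f x| + |t| * |v x| := by rw [abs_mul]
      _ ≤ Cf + |t| * Cv := add_le_add h1 (mul_le_mul_of_nonneg_left h2 (abs_nonneg t))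
  have hgs : ∀ x, x ∉ Icc (-b) b → g x = 0 := fun x hx ↦ by
    simp only [hg, hfs x hx, hvs x hx, mul_zero, add_zero]
  have htv_m : Measurable fun x ↦ t * v x := hv.const_mul t
  have htv_b : ∀ x, |t * v x| ≤ |t| * Cv := fun x ↦ by
    rw [abs_mul]; exact mul_le_mul_of_nonneg_left (hCv x) (abs_nonneg t)
  have htv_s : ∀ x, x ∉ Icc (-b) b → t * v x = 0 := fun x hx ↦ by rw [hvs x hx, mul_zero]
  -- the form along g
  have hQ : primeShiftForm b g = primeShiftForm b f
      + 2 * t * (∫ x, (∑ n ∈ weilPrimeIndex b, (Λ n : ℝ) / Real.sqrt n *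
          (f (x - Real.log n) + f (x + Real.log n))) * v x) + t ^ 2 * primeShiftForm b v := by
    have h := primeShiftForm_smul_add (b := b) hf htv_m hCf htv_b hfs htv_s 1
    have e1 : (fun x ↦ (1 : ℝ) * f x + t * v x) = g := funext fun x ↦ by simp only [hg, one_mul]
    rw [e1] at h
    rw [h, primeShiftForm_const_mul v t]
    have e2 : (fun x ↦ (∑ n ∈ weilPrimeIndex b, (Λ n : ℝ) / Real.sqrt n *
        (f (x - Real.log n) + f (x + Real.log n))) * (t * v x))
        = fun x ↦ t * ((∑ n ∈ weilPrimeIndex b, (Λ n : ℝ) / Real.sqrt n *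
          (f (x - Real.log n) + f (x + Real.log n))) * v x) := funext fun x ↦ by ring
    rw [e2, integral_const_mul]
    ring
  have hN : ∫ x, g x ^ 2 = (∫ x, f x ^ 2) + t ^ 2 * ∫ x, v x ^ 2 :=
    integral_sq_add_smul_eq hf hv hCf hCv hfs hvs horth t
  have hv2 : 0 ≤ ∫ x, v x ^ 2 := integral_nonneg fun x ↦ sq_nonneg _
  have hgpos : 0 < ∫ x, g x ^ 2 := by rw [hN]; positivity
  have hmem : primeShiftForm b g / ∫ x, g x ^ 2 ∈ primeShiftQuotients b :=
    ⟨g, Cf + |t| * Cv, hgm, hgb, hgs, hgpos, rfl⟩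
  have h := le_csSup (primeShiftQuotients_bddAbove b) hmem
  rw [hQ, hN] at h
  exact h

/-! ## §2 The cosh profile and its residual direction -/

/-- `∫ (T_b C)·C = Q_b(C)` for an admissible `C`: the form is the quadratic form of the prime-shift operator. -/
theorem integral_primeShiftOp_mul_self (hf : Measurable f) (hCf : ∀ x, |f x| ≤ Cf)
    (hfs : ∀ x, x ∉ Icc (-b) b → f x = 0) :
    ∫ x, (∑ n ∈ weilPrimeIndex b, (Λ n : ℝ) / Real.sqrt n * (f (x - Real.log n) + f (x + Real.log n))) * f x
      = primeShiftForm b f := by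
  have h := bilinear_eq_integral_primeShiftOp_mul (b := b) hf hf hCf hCf hfs
  have e : ∑ n ∈ weilPrimeIndex b, 2 * ((Λ n : ℝ) / Real.sqrt n) *
      ((∫ x, f (x - Real.log n) * f x) + ∫ x, f (x - Real.log n) * f x) = 2 * primeShiftForm b f := by
    unfold primeShiftForm
    rw [Finset.mul_sum]
    exact Finset.sum_congr rfl fun n _ ↦ by ring
  rw [e] at h
  linarith

variable (b)

/-- `T_b C_b`, the prime-shift operator applied to the cosh profile (a bounded measurable function). -/
theorem measurable_primeShiftOp_coshTest :
    Measurable fun x ↦ ∑ n ∈ weilPrimeIndex b, (Λ n : ℝ) / Real.sqrt n *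
      ((Icc (-b) b).indicator (fun y ↦ Real.cosh (y / 2)) (x - Real.log n)
        + (Icc (-b) b).indicator (fun y ↦ Real.cosh (y / 2)) (x + Real.log n)) :=
  measurable_primeShiftOp (FloorCosh.coshTest_admissible b).1

variable {b}

/-- The residual direction `r = 1_{[−b,b]}(T_bC_b − R·C_b)` is admissible (measurable, bounded, vanishing off `[−b, b]`). -/
theorem residual_admissible (R : ℝ) :
    Measurable ((Icc (-b) b).indicator fun x ↦
        (∑ n ∈ weilPrimeIndex b, (Λ n : ℝ) / Real.sqrt n *
          ((Icc (-b) b).indicator (fun y ↦ Real.cosh (y / 2)) (x - Real.log n)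
            + (Icc (-b) b).indicator (fun y ↦ Real.cosh (y / 2)) (x + Real.log n)))
        - R * (Icc (-b) b).indicator (fun y ↦ Real.cosh (y / 2)) x)
    ∧ (∀ x, |(Icc (-b) b).indicator (fun x ↦
        (∑ n ∈ weilPrimeIndex b, (Λ n : ℝ) / Real.sqrt n *
          ((Icc (-b) b).indicator (fun y ↦ Real.cosh (y / 2)) (x - Real.log n)
            + (Icc (-b) b).indicator (fun y ↦ Real.cosh (y / 2)) (x + Real.log n)))
        - R * (Icc (-b) b).indicator (fun y ↦ Real.cosh (y / 2)) x) x|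
        ≤ 2 * (∑ n ∈ weilPrimeIndex b, (Λ n : ℝ) / Real.sqrt n) * Real.cosh (b / 2) + |R| * Real.cosh (b / 2))
    ∧ (∀ x, x ∉ Icc (-b) b → (Icc (-b) b).indicator (fun x ↦
        (∑ n ∈ weilPrimeIndex b, (Λ n : ℝ) / Real.sqrt n *
          ((Icc (-b) b).indicator (fun y ↦ Real.cosh (y / 2)) (x - Real.log n)
            + (Icc (-b) b).indicator (fun y ↦ Real.cosh (y / 2)) (x + Real.log n)))
        - R * (Icc (-b) b).indicator (fun y ↦ Real.cosh (y / 2)) x) x = 0) := by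
  obtain ⟨hCm, hCb, hCs⟩ := FloorCosh.coshTest_admissible b
  refine ⟨((measurable_primeShiftOp_coshTest b).sub (hCm.const_mul R)).indicator measurableSet_Icc,
    fun x ↦ ?_, fun x hx ↦ indicator_of_notMem hx _⟩
  have hA : 0 ≤ 2 * (∑ n ∈ weilPrimeIndex b, (Λ n : ℝ) / Real.sqrt n) * Real.cosh (b / 2) := by
    have : 0 ≤ ∑ n ∈ weilPrimeIndex b, (Λ n : ℝ) / Real.sqrt n :=
      Finset.sum_nonneg fun n _ ↦ div_nonneg ArithmeticFunction.vonMangoldt_nonneg (Real.sqrt_nonneg _)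
    have := (Real.cosh_pos (b / 2)).le
    positivity
  by_cases hx : x ∈ Icc (-b) b
  · rw [indicator_of_mem hx]
    refine (abs_sub _ _).trans (add_le_add (abs_primeShiftOp_le hCb x) ?_)
    rw [abs_mul]
    exact mul_le_mul_of_nonneg_left (hCb x) (abs_nonneg R)
  · rw [indicator_of_notMem hx, abs_zero]
    have := (Real.cosh_pos (b / 2)).le
    positivity

/-- Orthogonality of the residual: `∫ C_b · 1_{[−b,b]}(T_bC_b − R_c C_b) = 0` with `R_c = Q_b(C_b)/(b + sinh b)` (`b > 0`). -/
theorem integral_coshTest_mul_residual (hb : 0 < b) :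
    ∫ x, (Icc (-b) b).indicator (fun y ↦ Real.cosh (y / 2)) x
        * (Icc (-b) b).indicator (fun x ↦
          (∑ n ∈ weilPrimeIndex b, (Λ n : ℝ) / Real.sqrt n *
            ((Icc (-b) b).indicator (fun y ↦ Real.cosh (y / 2)) (x - Real.log n)
              + (Icc (-b) b).indicator (fun y ↦ Real.cosh (y / 2)) (x + Real.log n)))
          - primeShiftForm b ((Icc (-b) b).indicator (fun y ↦ Real.cosh (y / 2))) / (b + Real.sinh b)
            * (Icc (-b) b).indicator (fun y ↦ Real.cosh (y / 2)) x) x = 0 := by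
  obtain ⟨hCm, hCb, hCs⟩ := FloorCosh.coshTest_admissible b
  set C := (Icc (-b) b).indicator (fun y ↦ Real.cosh (y / 2)) with hC
  set TC : ℝ → ℝ := fun x ↦ ∑ n ∈ weilPrimeIndex b, (Λ n : ℝ) / Real.sqrt n *
    (C (x - Real.log n) + C (x + Real.log n)) with hTC
  set R := primeShiftForm b C / (b + Real.sinh b) with hR
  have hN : ∫ x, C x ^ 2 = b + Real.sinh b := FloorCosh.integral_coshTest_sq hb.le
  have hN0 : 0 < b + Real.sinh b := by have := Real.sinh_pos_iff.2 hb; linarith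
  -- pointwise: C · r = C · TC − R · C²
  have hpt : ∀ x, C x * (Icc (-b) b).indicator (fun x ↦ TC x - R * C x) x = TC x * C x - R * C x ^ 2 := by
    intro x
    by_cases hx : x ∈ Icc (-b) b
    · rw [indicator_of_mem hx]; ring
    · rw [indicator_of_notMem hx, show C x = 0 from hCs x hx]; ring
  have hTCm : Measurable TC := measurable_primeShiftOp hCm
  have hTCb : ∀ x, |TC x| ≤ 2 * (∑ n ∈ weilPrimeIndex b, (Λ n : ℝ) / Real.sqrt n) * Real.cosh (b / 2) :=
    fun x ↦ abs_primeShiftOp_le hCb x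
  have i1 : Integrable fun x ↦ TC x * C x := integrable_mul_admissible hTCm hTCb hCm hCb hCs
  have i2 : Integrable fun x ↦ C x ^ 2 := integrable_sq_admissible hCm hCb hCs
  have e : (fun x ↦ C x * (Icc (-b) b).indicator (fun x ↦ TC x - R * C x) x)
      = fun x ↦ TC x * C x - R * C x ^ 2 := funext hpt
  show ∫ x, C x * (Icc (-b) b).indicator (fun x ↦ TC x - R * C x) x = 0
  rw [e, integral_sub i1 (i2.const_mul R), integral_const_mul, integral_primeShiftOp_mul_self hCm hCb hCs, hN, hR]
  field_simp
  ring

/-- The coupling identity: `∫ (T_bC_b) · r = ∫ r²` for the residual `r = 1_{[−b,b]}(T_bC_b − R_c C_b)` (`b > 0`). -/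
theorem integral_primeShiftOp_coshTest_mul_residual (hb : 0 < b) :
    ∫ x, (∑ n ∈ weilPrimeIndex b, (Λ n : ℝ) / Real.sqrt n *
          ((Icc (-b) b).indicator (fun y ↦ Real.cosh (y / 2)) (x - Real.log n)
            + (Icc (-b) b).indicator (fun y ↦ Real.cosh (y / 2)) (x + Real.log n)))
        * (Icc (-b) b).indicator (fun x ↦
          (∑ n ∈ weilPrimeIndex b, (Λ n : ℝ) / Real.sqrt n *
            ((Icc (-b) b).indicator (fun y ↦ Real.cosh (y / 2)) (x - Real.log n)
              + (Icc (-b) b).indicator (fun y ↦ Real.cosh (y / 2)) (x + Real.log n)))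
          - primeShiftForm b ((Icc (-b) b).indicator (fun y ↦ Real.cosh (y / 2))) / (b + Real.sinh b)
            * (Icc (-b) b).indicator (fun y ↦ Real.cosh (y / 2)) x) x
      = ∫ x, ((Icc (-b) b).indicator (fun x ↦
          (∑ n ∈ weilPrimeIndex b, (Λ n : ℝ) / Real.sqrt n *
            ((Icc (-b) b).indicator (fun y ↦ Real.cosh (y / 2)) (x - Real.log n)
              + (Icc (-b) b).indicator (fun y ↦ Real.cosh (y / 2)) (x + Real.log n)))
          - primeShiftForm b ((Icc (-b) b).indicator (fun y ↦ Real.cosh (y / 2))) / (b + Real.sinh b)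
            * (Icc (-b) b).indicator (fun y ↦ Real.cosh (y / 2)) x) x) ^ 2 := by
  obtain ⟨hCm, hCb, hCs⟩ := FloorCosh.coshTest_admissible b
  set C := (Icc (-b) b).indicator (fun y ↦ Real.cosh (y / 2)) with hC
  set TC : ℝ → ℝ := fun x ↦ ∑ n ∈ weilPrimeIndex b, (Λ n : ℝ) / Real.sqrt n *
    (C (x - Real.log n) + C (x + Real.log n)) with hTC
  set R := primeShiftForm b C / (b + Real.sinh b) with hR
  set r := (Icc (-b) b).indicator (fun x ↦ TC x - R * C x) with hr
  have horth : ∫ x, C x * r x = 0 := integral_coshTest_mul_residual hb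
  -- pointwise: TC · r − r² = R · (C · r)
  have hpt : ∀ x, TC x * r x = r x ^ 2 + R * (C x * r x) := by
    intro x
    by_cases hx : x ∈ Icc (-b) b
    · simp only [hr, indicator_of_mem hx]; ring
    · simp only [hr, indicator_of_notMem hx]; ring
  obtain ⟨hrm, hrb, hrs⟩ := residual_admissible (b := b) R
  have i1 : Integrable fun x ↦ r x ^ 2 := integrable_sq_admissible hrm hrb hrs
  have i2 : Integrable fun x ↦ C x * r x := integrable_mul_admissible hCm hCb hrm hrb hrs
  show ∫ x, TC x * r x = ∫ x, r x ^ 2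
  rw [show (fun x ↦ TC x * r x) = fun x ↦ r x ^ 2 + R * (C x * r x) from funext hpt,
    integral_add i1 (i2.const_mul R), integral_const_mul, horth, mul_zero, add_zero]

/-- **Second-order lower bound along the cosh profile (RH-free).** With `C_b = 1_{[−b,b]}cosh(·/2)`, `N = b + sinh b`,
`R_c = Q_b(C_b)/N`, the residual `r = 1_{[−b,b]}(T_bC_b − R_c C_b)` and `ρ = ∫ r²`: for every real `t`,
`(R_c·N + 2tρ + t²·Q_b(r)) / (N + t²ρ) ≤ λ_max(b)` (`b > 0`). -/
theorem coshResidual_rayleighTwo_le_farCoercivityFloor (hb : 0 < b) (r : ℝ → ℝ)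
    (hr : r = (Icc (-b) b).indicator (fun x ↦
          (∑ n ∈ weilPrimeIndex b, (Λ n : ℝ) / Real.sqrt n *
            ((Icc (-b) b).indicator (fun y ↦ Real.cosh (y / 2)) (x - Real.log n)
              + (Icc (-b) b).indicator (fun y ↦ Real.cosh (y / 2)) (x + Real.log n)))
          - primeShiftForm b ((Icc (-b) b).indicator (fun y ↦ Real.cosh (y / 2))) / (b + Real.sinh b)
            * (Icc (-b) b).indicator (fun y ↦ Real.cosh (y / 2)) x)) (t : ℝ) :
    (primeShiftForm b ((Icc (-b) b).indicator (fun y ↦ Real.cosh (y / 2))) / (b + Real.sinh b) * (b + Real.sinh b)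
        + 2 * t * (∫ x, r x ^ 2) + t ^ 2 * primeShiftForm b r) / ((b + Real.sinh b) + t ^ 2 * ∫ x, r x ^ 2)
      ≤ farCoercivityFloor b := by
  obtain ⟨hCm, hCb, hCs⟩ := FloorCosh.coshTest_admissible b
  have hN : ∫ x, (Icc (-b) b).indicator (fun y ↦ Real.cosh (y / 2)) x ^ 2 = b + Real.sinh b :=
    FloorCosh.integral_coshTest_sq hb.le
  have hN0 : 0 < b + Real.sinh b := by have := Real.sinh_pos_iff.2 hb; linarith
  obtain ⟨hrm, hrb, hrs⟩ := residual_admissible (b := b)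
    (primeShiftForm b ((Icc (-b) b).indicator (fun y ↦ Real.cosh (y / 2))) / (b + Real.sinh b))
  rw [← hr] at hrm hrb hrs
  have horth := integral_coshTest_mul_residual hb
  have hcoup := integral_primeShiftOp_coshTest_mul_residual hb
  rw [← hr] at horth hcoup
  have h := rayleighTwo_le_farCoercivityFloor hCm hrm hCb hrb hCs hrs horth (by rw [hN]; exact hN0) t
  rw [hcoup, hN] at h
  convert h using 2
  field_simp

/-- **The `t = 1/R_c` instance**: `R_c + (ρ/R_c + Q_b(r)/R_c²)/(N + ρ/R_c²) ≤ λ_max(b)` when the cosh quotient `R_c` is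
positive — the gap `λ_max − R_c` is at least the second-order coupling `J/R_c` (`J = ρ/N`) corrected by the factor
`(1 + Q_b(r)/(ρR_c))/(1 + J/R_c²)` (memo §15.7). -/
theorem coshQuotient_add_secondOrder_le_farCoercivityFloor (hb : 0 < b) (r : ℝ → ℝ)
    (hr : r = (Icc (-b) b).indicator (fun x ↦
          (∑ n ∈ weilPrimeIndex b, (Λ n : ℝ) / Real.sqrt n *
            ((Icc (-b) b).indicator (fun y ↦ Real.cosh (y / 2)) (x - Real.log n)
              + (Icc (-b) b).indicator (fun y ↦ Real.cosh (y / 2)) (x + Real.log n)))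
          - primeShiftForm b ((Icc (-b) b).indicator (fun y ↦ Real.cosh (y / 2))) / (b + Real.sinh b)
            * (Icc (-b) b).indicator (fun y ↦ Real.cosh (y / 2)) x))
    (hRc : 0 < primeShiftForm b ((Icc (-b) b).indicator (fun y ↦ Real.cosh (y / 2))) / (b + Real.sinh b)) :
    primeShiftForm b ((Icc (-b) b).indicator (fun y ↦ Real.cosh (y / 2))) / (b + Real.sinh b)
        + ((∫ x, r x ^ 2) / (primeShiftForm b ((Icc (-b) b).indicator (fun y ↦ Real.cosh (y / 2))) / (b + Real.sinh b))
            + primeShiftForm b r / (primeShiftForm b ((Icc (-b) b).indicator (fun y ↦ Real.cosh (y / 2))) / (b + Real.sinh b)) ^ 2)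
          / ((b + Real.sinh b)
            + (∫ x, r x ^ 2) / (primeShiftForm b ((Icc (-b) b).indicator (fun y ↦ Real.cosh (y / 2))) / (b + Real.sinh b)) ^ 2)
      ≤ farCoercivityFloor b := by
  set R := primeShiftForm b ((Icc (-b) b).indicator (fun y ↦ Real.cosh (y / 2))) / (b + Real.sinh b) with hR
  set N := b + Real.sinh b with hNdef
  set ρ := ∫ x, r x ^ 2 with hρ
  have hN0 : 0 < N := by have := Real.sinh_pos_iff.2 hb; rw [hNdef]; linarith
  have hρ0 : 0 ≤ ρ := integral_nonneg fun x ↦ sq_nonneg _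
  have h := coshResidual_rayleighTwo_le_farCoercivityFloor hb r hr (1 / R)
  rw [← hR] at h
  have e : (R * N + 2 * (1 / R) * ρ + (1 / R) ^ 2 * primeShiftForm b r) / (N + (1 / R) ^ 2 * ρ)
      = R + (ρ / R + primeShiftForm b r / R ^ 2) / (N + ρ / R ^ 2) := by
    have hR0 : R ≠ 0 := hRc.ne'
    have hD : N + ρ / R ^ 2 ≠ 0 := by positivity
    field_simp
    ring
  rw [e] at h
  exact h

end FloorSecondOrder

end Summit.RiemannHypothesis.RiemannHypothesis.Theorems.WeilFormatC
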